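import Summits.QuantumFields.YangMills.Theorems.PoincareLipschitzAxialStationarity
import Summits.QuantumFields.YangMills.Theorems.PoincareLipschitzRadialCutoffLetters
import HarnessLib

/-!
# Crux `BlockLipschitzL` (stmt-QuantumFields-23533) ∕ `HistoryTailL` (stmt-QuantumFields-19936), LINE 25 «CompactnessTransfer»,
# stub S1″ row (M) «MONOTONICITY» — FILE δ1 «THE RADIAL IDENTITY»

Cell `ym3-torus` (YM ladder rung R3 = continuum SU(2) Yang–Mills on T³ — a RUNG, NOT the Clay problem: not d = 4, not
infinite volume, not a mass gap); WIDTH helper seat `ym-ust-19936-w2` g13 (split (δ) = (δ1) w2 ∕ (δ2) w3 g15, bus 13:14Z).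
Helper `--supports stmt-QuantumFields-19936`; THEOREMS ONLY (0 `def`, 0 `sorry`, default heartbeats); imports: FILE γ
✓`PoincareLipschitzAxialStationarity` (axial stationarity of ball minimisers; through it γ-letters, β, α, lit `SobolevDomain`), w3 g15's
✓`PoincareLipschitzRadialCutoffLetters` (the radial test functions `f_k(x) = g(‖x−y‖²∕τ²)·(x_k − y_k)`: gradient, smoothness,
support; the cutoff `g_κ`).

WHAT THIS FILE DOES.  Summing FILE γ's axial identities over the three axes with the RADIAL test functions
`f_k := θ_τ·(x_k − y_k)`, `θ_τ(x) := g(‖x − y‖²∕τ²)` (`g ∈ C^∞`, `g = 0` on `[1,∞)`, `0 < τ < ρ`), gives the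
derivative-free form of the monotonicity identity for a ball minimiser `(U, G)` on `B_ρ(y)` (★★★ `radial_identity`):
`∫_{B_ρ(y)} ( g(s) + 2s·g′(s) ) · Σ_i‖G e_i‖²  =  (4∕τ²) · ∫_{B_ρ(y)} g′(s) · ‖Σ_i (x_i − y_i)•G e_i‖²`,  `s := ‖x−y‖²∕τ²`
(the right-hand integrand is `τ²·g′(s)·‖∂_r U‖²·r²`-shaped: the radial derivative).  For a non-increasing profile the
right-hand side is `≤ 0` (★★ `radial_inequality`), and at the cutoff `g_κ(s) = smoothTransition((1−s)∕κ)` this is the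
socket `hRad` of w3 g15's (δ2) «monotonicity from the radial inequality» (★★ `radial_inequality_cutoff`, binders verbatim).
Pointwise algebra: ★ `radial_sum_pointwise` (`Σ_k[Σ_i 2∂_if_k⟪g_i,g_k⟫ − ∂_kf_k·Σ_i‖g_i‖²] = 4c‖Σ_i d_i•g_i‖² − (θ + 2cΣ_k d_k²)·Σ_i‖g_i‖²`
with `∂_if_k = 2c·d_i d_k + θ·δ_{ik}`) and the Gram identity `norm_sum_smul_sq`.

HONEST SCOPE.  Calculus of variations for Sobolev maps; (M) itself is (δ2) (w3 g15) on top of this file; nothing of (M),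
(C), (R), S1″, S2♭″, `hHalvingBand`, K1, `MeanDeviationL`, `BlockLipschitzL`, `HistoryTailL` is proved here.  YM₃ on T³ is
rung R3, not Clay; YM gap NOT proved; no summit statement is proved here.

References: L. Simon, Theorems on Regularity and Singularity of Energy Minimizing Maps (1996) [Simon1996] (§2.4, the
monotonicity identity via the radial variation `X = η(r)·(x − y)`); P. Price, Manuscripta Math. 43 (1983) 131–166
[Price1983] (§1); R. Schoen, K. Uhlenbeck, J. Differential Geom. 17 (1982) 307–335 [SchoenUhlenbeck1982] (§2).
-/

set_option autoImplicit false

noncomputable section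

open MeasureTheory Set Function Filter Topology Metric TopologicalSpace
open scoped ContDiff RealInnerProductSpace BigOperators

namespace Summit.QuantumFields.YangMills.Theorems.PoincareLipschitzRadialVariation

open Literature.Analysis.FunctionSpaces (IsTestFunctionOn HasWeakFDerivOn)
open Summit.QuantumFields.YangMills.Theorems.PoincareLipschitzAxialStationarityLetters
open Summit.QuantumFields.YangMills.Theorems.PoincareLipschitzAxialStationarity
open Summit.QuantumFields.YangMills.Theorems.PoincareLipschitzRadialCutoffLetters

variable {F : Type*} [NormedAddCommGroup F] [InnerProductSpace ℝ F]

/-! ## §1 Pointwise algebra of the radial sum -/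

/-- **Gram identity**: `‖Σ_i d_i • v_i‖² = Σ_i Σ_k d_i d_k ⟪v_i, v_k⟫`. [folklore] -/
theorem norm_sum_smul_sq {ι : Type*} [Fintype ι] (d : ι → ℝ) (v : ι → F) :
    ‖∑ i, d i • v i‖ ^ 2 = ∑ i, ∑ k, d i * d k * ⟪v i, v k⟫ := by
  rw [← real_inner_self_eq_norm_sq, sum_inner]
  refine Finset.sum_congr rfl fun i _ => ?_
  rw [inner_sum]
  refine Finset.sum_congr rfl fun k _ => ?_
  rw [real_inner_smul_left, real_inner_smul_right, mul_assoc]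

/-- ★ **THE RADIAL SUM, POINTWISE.**  With `∂_if_k = 2c·d_i·d_k + θ·δ_{ki}` (the gradient of `f_k = θ·d_k`,
`θ = g(s)`, `c = g′(s)∕τ²`, `d = x − y`):
`Σ_k [ Σ_i 2∂_if_k⟪v_i,v_k⟫ − ∂_kf_k·Σ_i‖v_i‖² ] = 4c·‖Σ_i d_i•v_i‖² − (θ + 2c·Σ_k d_k²)·Σ_i‖v_i‖²`. [folklore] -/
theorem radial_sum_pointwise (v : Fin 3 → F) (d : Fin 3 → ℝ) (θ c : ℝ) (df : Fin 3 → Fin 3 → ℝ)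
    (hdf : ∀ k i : Fin 3, df k i = 2 * c * d i * d k + θ * (if k = i then 1 else 0)) :
    ∑ k : Fin 3, ((∑ i : Fin 3, 2 * df k i * ⟪v i, v k⟫) - df k k * ∑ i : Fin 3, ‖v i‖ ^ 2) =
      4 * c * ‖∑ i : Fin 3, d i • v i‖ ^ 2 - (θ + 2 * c * ∑ k : Fin 3, d k ^ 2) * ∑ i : Fin 3, ‖v i‖ ^ 2 := by
  rw [norm_sum_smul_sq]
  simp only [hdf, Fin.sum_univ_three, Fin.isValue]
  simp only [Fin.isValue, show ((0 : Fin 3) = 1) = False by decide, show ((0 : Fin 3) = 2) = False by decide,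
    show ((1 : Fin 3) = 0) = False by decide, show ((1 : Fin 3) = 2) = False by decide,
    show ((2 : Fin 3) = 0) = False by decide, show ((2 : Fin 3) = 1) = False by decide, if_false, if_true,
    real_inner_self_eq_norm_sq]
  ring

/-- **Coordinates square-sum to the norm**: `Σ_k (x_k − y_k)² = ‖x − y‖²` in `ℝ³`. [folklore] -/
theorem sum_coord_sub_sq (x y : EuclideanSpace ℝ (Fin 3)) :
    ∑ k : Fin 3, (x k - y k) ^ 2 = ‖x - y‖ ^ 2 := by
  rw [EuclideanSpace.real_norm_sq_eq]
  refine Finset.sum_congr rfl fun k _ => ?_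
  rw [PiLp.sub_apply]

/-! ## §2 The radial identity for ball minimisers -/

/-- ★★★ **THE RADIAL IDENTITY (derivative-free monotonicity identity).**  Let `U` be weakly differentiable on the open
`Ω ⊆ ℝ³` with weak gradient `G`, unit on `Ω`, of finite energy, and energy minimising on the ball `B_ρ(y) ⊆ Ω` among
finite-energy unit `W^{1,2}(Ω)` competitors agreeing with `U` off a smaller concentric ball ([Simon1996, §2.1] in Sobolev
phrasing, the `hmin` row of FILE γ).  Then for every smooth profile `g` vanishing on `[1, ∞)` and every `0 < τ < ρ`,
with `s(x) := ‖x − y‖²∕τ²`: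
`∫_{B_ρ(y)} (g(s) + 2s·g′(s))·Σ_i‖G e_i‖² = (4∕τ²)·∫_{B_ρ(y)} g′(s)·‖Σ_i (x_i − y_i)•G e_i‖²`.
Proof: FILE γ's `axial_stationarity` for the three radial test functions `f_k = g(s)·(x_k − y_k)` (w3 g15's letters:
gradient `∂_if_k = 2g′(s)τ⁻²·d_i d_k + g(s)δ_{ik}`, support `⊆ B̄_τ(y) ⊂ B_{(τ+ρ)∕2}(y)`), summed over `k`
(`radial_sum_pointwise`, `Σ_k d_k² = ‖x−y‖²`). [cite: Simon1996, §2.4; Price1983, §1] -/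
theorem radial_identity {Ω : Opens (EuclideanSpace ℝ (Fin 3))}
    {U : EuclideanSpace ℝ (Fin 3) → F} {G : EuclideanSpace ℝ (Fin 3) → EuclideanSpace ℝ (Fin 3) →L[ℝ] F}
    (hU : HasWeakFDerivOn Ω volume U G) (hU1 : ∀ x ∈ (Ω : Set (EuclideanSpace ℝ (Fin 3))), ‖U x‖ = 1)
    (hGi : IntegrableOn (fun x => ∑ i : Fin 3, ‖G x (EuclideanSpace.single i (1:ℝ))‖ ^ 2) (Ω : Set _) volume)
    {y : EuclideanSpace ℝ (Fin 3)} {ρ : ℝ} (hB : ball y ρ ⊆ (Ω : Set _))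
    (hmin : ∀ (W : EuclideanSpace ℝ (Fin 3) → F) (GW : EuclideanSpace ℝ (Fin 3) → EuclideanSpace ℝ (Fin 3) →L[ℝ] F),
      HasWeakFDerivOn Ω volume W GW → (∀ x ∈ (Ω : Set (EuclideanSpace ℝ (Fin 3))), ‖W x‖ = 1) →
      IntegrableOn (fun x => ∑ i : Fin 3, ‖GW x (EuclideanSpace.single i (1:ℝ))‖ ^ 2) (Ω : Set _) volume →
      (∃ ρ'' : ℝ, ρ'' < ρ ∧ ∀ x, x ∉ ball y ρ'' → W x = U x) →
      ∫ x in ball y ρ, ∑ i : Fin 3, ‖G x (EuclideanSpace.single i (1:ℝ))‖ ^ 2 ≤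
        ∫ x in ball y ρ, ∑ i : Fin 3, ‖GW x (EuclideanSpace.single i (1:ℝ))‖ ^ 2)
    {g : ℝ → ℝ} (hg : ContDiff ℝ ∞ g) (hg0 : ∀ s : ℝ, 1 ≤ s → g s = 0) {τ : ℝ} (hτ : 0 < τ) (hτρ : τ < ρ) :
    ∫ x in ball y ρ, (g (‖x - y‖ ^ 2 / τ ^ 2) + 2 * (‖x - y‖ ^ 2 / τ ^ 2) * deriv g (‖x - y‖ ^ 2 / τ ^ 2)) *
        ∑ i : Fin 3, ‖G x (EuclideanSpace.single i (1:ℝ))‖ ^ 2 =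
      4 / τ ^ 2 * ∫ x in ball y ρ, deriv g (‖x - y‖ ^ 2 / τ ^ 2) *
        ‖∑ i : Fin 3, (x i - y i) • G x (EuclideanSpace.single i (1:ℝ))‖ ^ 2 := by
  have hBm : MeasurableSet (ball y ρ) := measurableSet_ball
  have hgd : Differentiable ℝ g := hg.differentiable (by simp)
  have hg'c : Continuous (deriv g) := hg.continuous_deriv (by simp)
  -- the intermediate radius
  have hρ'1 : τ < (τ + ρ) / 2 := by linarith
  have hρ'2 : (τ + ρ) / 2 < ρ := by linarith
  -- the radial test functions
  have hfc : ∀ k : Fin 3, ContDiff ℝ ∞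
      (fun x : EuclideanSpace ℝ (Fin 3) => g (‖x - y‖ ^ 2 / τ ^ 2) * (x k - y k)) :=
    fun k => contDiff_testFun hg y τ k
  have hfs : ∀ k : Fin 3, tsupport (fun x : EuclideanSpace ℝ (Fin 3) => g (‖x - y‖ ^ 2 / τ ^ 2) * (x k - y k)) ⊆
      ball y ((τ + ρ) / 2) :=
    fun k => (tsupport_testFun_subset hg0 y hτ k).trans (closedBall_subset_ball hρ'1)
  have hfK : ∀ k : Fin 3, HasCompactSupport
      (fun x : EuclideanSpace ℝ (Fin 3) => g (‖x - y‖ ^ 2 / τ ^ 2) * (x k - y k)) :=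
    fun k => IsCompact.of_isClosed_subset (isCompact_closedBall y τ) (isClosed_tsupport _)
      (tsupport_testFun_subset hg0 y hτ k)
  have hf'c : ∀ k : Fin 3, Continuous (fderiv ℝ
      (fun x : EuclideanSpace ℝ (Fin 3) => g (‖x - y‖ ^ 2 / τ ^ 2) * (x k - y k))) :=
    fun k => (hfc k).continuous_fderiv (by simp)
  -- FILE γ for each axis
  have key : ∀ k : Fin 3, ∫ x in ball y ρ,
      ((∑ i : Fin 3, 2 * fderiv ℝ (fun x : EuclideanSpace ℝ (Fin 3) => g (‖x - y‖ ^ 2 / τ ^ 2) * (x k - y k)) x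
          (EuclideanSpace.single i (1:ℝ)) *
          ⟪G x (EuclideanSpace.single i (1:ℝ)), G x (EuclideanSpace.single k (1:ℝ))⟫) -
        fderiv ℝ (fun x : EuclideanSpace ℝ (Fin 3) => g (‖x - y‖ ^ 2 / τ ^ 2) * (x k - y k)) x
          (EuclideanSpace.single k (1:ℝ)) * ∑ i : Fin 3, ‖G x (EuclideanSpace.single i (1:ℝ))‖ ^ 2) = 0 :=
    fun k => axial_stationarity hU hU1 hGi hρ'2 hB hmin (hfc k) (hfs k) k
  -- integrability of each axial integrand on the ball
  have hGmB : AEStronglyMeasurable G (volume.restrict (ball y ρ)) :=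
    hU.locallyIntegrableOn_deriv.aestronglyMeasurable.mono_set hB
  have hGiB : IntegrableOn (fun x => ∑ i : Fin 3, ‖G x (EuclideanSpace.single i (1:ℝ))‖ ^ 2) (ball y ρ) volume :=
    hGi.mono_set hB
  have Ik : ∀ k : Fin 3, IntegrableOn (fun x =>
      (∑ i : Fin 3, 2 * fderiv ℝ (fun x : EuclideanSpace ℝ (Fin 3) => g (‖x - y‖ ^ 2 / τ ^ 2) * (x k - y k)) x
          (EuclideanSpace.single i (1:ℝ)) *
          ⟪G x (EuclideanSpace.single i (1:ℝ)), G x (EuclideanSpace.single k (1:ℝ))⟫) -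
        fderiv ℝ (fun x : EuclideanSpace ℝ (Fin 3) => g (‖x - y‖ ^ 2 / τ ^ 2) * (x k - y k)) x
          (EuclideanSpace.single k (1:ℝ)) * ∑ i : Fin 3, ‖G x (EuclideanSpace.single i (1:ℝ))‖ ^ 2)
      (ball y ρ) volume := by
    intro k
    obtain ⟨M, hM⟩ := ((hfK k).fderiv (𝕜 := ℝ)).exists_bound_of_continuous (hf'c k)
    exact integrableOn_firstVariation hGmB hGiB (hf'c k) hM k
  -- sum over the axes
  have hsum : ∫ x in ball y ρ, ∑ k : Fin 3,
      ((∑ i : Fin 3, 2 * fderiv ℝ (fun x : EuclideanSpace ℝ (Fin 3) => g (‖x - y‖ ^ 2 / τ ^ 2) * (x k - y k)) x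
          (EuclideanSpace.single i (1:ℝ)) *
          ⟪G x (EuclideanSpace.single i (1:ℝ)), G x (EuclideanSpace.single k (1:ℝ))⟫) -
        fderiv ℝ (fun x : EuclideanSpace ℝ (Fin 3) => g (‖x - y‖ ^ 2 / τ ^ 2) * (x k - y k)) x
          (EuclideanSpace.single k (1:ℝ)) * ∑ i : Fin 3, ‖G x (EuclideanSpace.single i (1:ℝ))‖ ^ 2) = 0 := by
    rw [integral_finsetSum _ (fun k _ => Ik k)]
    exact Finset.sum_eq_zero fun k _ => key k
  -- total integrability
  have Itot : IntegrableOn (fun x => ∑ k : Fin 3,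
      ((∑ i : Fin 3, 2 * fderiv ℝ (fun x : EuclideanSpace ℝ (Fin 3) => g (‖x - y‖ ^ 2 / τ ^ 2) * (x k - y k)) x
          (EuclideanSpace.single i (1:ℝ)) *
          ⟪G x (EuclideanSpace.single i (1:ℝ)), G x (EuclideanSpace.single k (1:ℝ))⟫) -
        fderiv ℝ (fun x : EuclideanSpace ℝ (Fin 3) => g (‖x - y‖ ^ 2 / τ ^ 2) * (x k - y k)) x
          (EuclideanSpace.single k (1:ℝ)) * ∑ i : Fin 3, ‖G x (EuclideanSpace.single i (1:ℝ))‖ ^ 2))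
      (ball y ρ) volume := integrable_finsetSum _ fun k _ => Ik k
  -- the pointwise identity
  have hpt : ∀ x : EuclideanSpace ℝ (Fin 3), ∑ k : Fin 3,
      ((∑ i : Fin 3, 2 * fderiv ℝ (fun x : EuclideanSpace ℝ (Fin 3) => g (‖x - y‖ ^ 2 / τ ^ 2) * (x k - y k)) x
          (EuclideanSpace.single i (1:ℝ)) *
          ⟪G x (EuclideanSpace.single i (1:ℝ)), G x (EuclideanSpace.single k (1:ℝ))⟫) -
        fderiv ℝ (fun x : EuclideanSpace ℝ (Fin 3) => g (‖x - y‖ ^ 2 / τ ^ 2) * (x k - y k)) x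
          (EuclideanSpace.single k (1:ℝ)) * ∑ i : Fin 3, ‖G x (EuclideanSpace.single i (1:ℝ))‖ ^ 2) =
      4 / τ ^ 2 * (deriv g (‖x - y‖ ^ 2 / τ ^ 2) * ‖∑ i : Fin 3, (x i - y i) • G x (EuclideanSpace.single i (1:ℝ))‖ ^ 2) -
        (g (‖x - y‖ ^ 2 / τ ^ 2) + 2 * (‖x - y‖ ^ 2 / τ ^ 2) * deriv g (‖x - y‖ ^ 2 / τ ^ 2)) *
          ∑ i : Fin 3, ‖G x (EuclideanSpace.single i (1:ℝ))‖ ^ 2 := by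
    intro x
    have h1 := radial_sum_pointwise (fun i => G x (EuclideanSpace.single i (1:ℝ))) (fun i => x i - y i)
      (g (‖x - y‖ ^ 2 / τ ^ 2)) (deriv g (‖x - y‖ ^ 2 / τ ^ 2) * (τ ^ 2)⁻¹)
      (fun k i => fderiv ℝ (fun x : EuclideanSpace ℝ (Fin 3) => g (‖x - y‖ ^ 2 / τ ^ 2) * (x k - y k)) x
        (EuclideanSpace.single i (1:ℝ)))
      (fun k i => fderiv_testFun_apply_single hgd y τ k i x)
    beta_reduce at h1
    rw [h1, sum_coord_sub_sq]
    have hτ2 : τ ^ 2 ≠ 0 := by positivity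
    field_simp
  simp_rw [hpt] at hsum Itot
  -- integrability of the density piece and of the radial piece
  have IP : IntegrableOn (fun x => (g (‖x - y‖ ^ 2 / τ ^ 2) + 2 * (‖x - y‖ ^ 2 / τ ^ 2) * deriv g (‖x - y‖ ^ 2 / τ ^ 2)) *
      ∑ i : Fin 3, ‖G x (EuclideanSpace.single i (1:ℝ))‖ ^ 2) (ball y ρ) volume := by
    have hc : Continuous fun x : EuclideanSpace ℝ (Fin 3) =>
        g (‖x - y‖ ^ 2 / τ ^ 2) + 2 * (‖x - y‖ ^ 2 / τ ^ 2) * deriv g (‖x - y‖ ^ 2 / τ ^ 2) := by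
      have hs : Continuous fun x : EuclideanSpace ℝ (Fin 3) => ‖x - y‖ ^ 2 / τ ^ 2 :=
        ((continuous_id.sub continuous_const).norm.pow 2).div_const _
      exact (hg.continuous.comp hs).add ((continuous_const.mul hs).mul (hg'c.comp hs))
    exact IntegrableOn.continuousOn_mul_of_subset hc.continuousOn hGiB (isCompact_closedBall y ρ) hBm ball_subset_closedBall
  have IR : IntegrableOn (fun x => 4 / τ ^ 2 * (deriv g (‖x - y‖ ^ 2 / τ ^ 2) *
      ‖∑ i : Fin 3, (x i - y i) • G x (EuclideanSpace.single i (1:ℝ))‖ ^ 2)) (ball y ρ) volume := by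
    exact (Itot.add IP).congr_fun (fun x _ => by simp only [Pi.add_apply, sub_add_cancel]) hBm
  rw [integral_sub IR IP, sub_eq_zero, integral_const_mul] at hsum
  exact hsum.symm

/-- ★★ **THE RADIAL INEQUALITY.**  Under the hypotheses of `radial_identity`, if moreover the profile is non-increasing
(`g′ ≤ 0`), then `∫_{B_ρ(y)} (g(s) + 2s·g′(s))·Σ_i‖G e_i‖² ≤ 0` (`s = ‖x−y‖²∕τ²`). [cite: Simon1996, §2.4] -/
theorem radial_inequality {Ω : Opens (EuclideanSpace ℝ (Fin 3))}
    {U : EuclideanSpace ℝ (Fin 3) → F} {G : EuclideanSpace ℝ (Fin 3) → EuclideanSpace ℝ (Fin 3) →L[ℝ] F}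
    (hU : HasWeakFDerivOn Ω volume U G) (hU1 : ∀ x ∈ (Ω : Set (EuclideanSpace ℝ (Fin 3))), ‖U x‖ = 1)
    (hGi : IntegrableOn (fun x => ∑ i : Fin 3, ‖G x (EuclideanSpace.single i (1:ℝ))‖ ^ 2) (Ω : Set _) volume)
    {y : EuclideanSpace ℝ (Fin 3)} {ρ : ℝ} (hB : ball y ρ ⊆ (Ω : Set _))
    (hmin : ∀ (W : EuclideanSpace ℝ (Fin 3) → F) (GW : EuclideanSpace ℝ (Fin 3) → EuclideanSpace ℝ (Fin 3) →L[ℝ] F),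
      HasWeakFDerivOn Ω volume W GW → (∀ x ∈ (Ω : Set (EuclideanSpace ℝ (Fin 3))), ‖W x‖ = 1) →
      IntegrableOn (fun x => ∑ i : Fin 3, ‖GW x (EuclideanSpace.single i (1:ℝ))‖ ^ 2) (Ω : Set _) volume →
      (∃ ρ'' : ℝ, ρ'' < ρ ∧ ∀ x, x ∉ ball y ρ'' → W x = U x) →
      ∫ x in ball y ρ, ∑ i : Fin 3, ‖G x (EuclideanSpace.single i (1:ℝ))‖ ^ 2 ≤
        ∫ x in ball y ρ, ∑ i : Fin 3, ‖GW x (EuclideanSpace.single i (1:ℝ))‖ ^ 2)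
    {g : ℝ → ℝ} (hg : ContDiff ℝ ∞ g) (hg0 : ∀ s : ℝ, 1 ≤ s → g s = 0) (hg' : ∀ s : ℝ, deriv g s ≤ 0)
    {τ : ℝ} (hτ : 0 < τ) (hτρ : τ < ρ) :
    ∫ x in ball y ρ, (g (‖x - y‖ ^ 2 / τ ^ 2) + 2 * (‖x - y‖ ^ 2 / τ ^ 2) * deriv g (‖x - y‖ ^ 2 / τ ^ 2)) *
        ∑ i : Fin 3, ‖G x (EuclideanSpace.single i (1:ℝ))‖ ^ 2 ≤ 0 := by
  rw [radial_identity hU hU1 hGi hB hmin hg hg0 hτ hτρ]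
  refine mul_nonpos_of_nonneg_of_nonpos (by positivity) (setIntegral_nonpos measurableSet_ball fun x _ => ?_)
  exact mul_nonpos_of_nonpos_of_nonneg (hg' _) (sq_nonneg _)

/-- ★★ **THE RADIAL INEQUALITY AT THE SMOOTH CUTOFF** `g_κ(s) = smoothTransition((1 − s)∕κ)` — the socket `hRad` of
w3 g15's (δ2) «monotonicity from the radial inequality», binders verbatim: for `0 < κ < 1`, `0 < τ < ρ`,
`∫_{B_ρ(y)} (g_κ(s) + 2s·g_κ′(s))·Σ_i‖G e_i‖² ≤ 0`. [cite: Simon1996, §2.4] -/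
theorem radial_inequality_cutoff {Ω : Opens (EuclideanSpace ℝ (Fin 3))}
    {U : EuclideanSpace ℝ (Fin 3) → F} {G : EuclideanSpace ℝ (Fin 3) → EuclideanSpace ℝ (Fin 3) →L[ℝ] F}
    (hU : HasWeakFDerivOn Ω volume U G) (hU1 : ∀ x ∈ (Ω : Set (EuclideanSpace ℝ (Fin 3))), ‖U x‖ = 1)
    (hGi : IntegrableOn (fun x => ∑ i : Fin 3, ‖G x (EuclideanSpace.single i (1:ℝ))‖ ^ 2) (Ω : Set _) volume)
    {y : EuclideanSpace ℝ (Fin 3)} {ρ : ℝ} (hB : ball y ρ ⊆ (Ω : Set _))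
    (hmin : ∀ (W : EuclideanSpace ℝ (Fin 3) → F) (GW : EuclideanSpace ℝ (Fin 3) → EuclideanSpace ℝ (Fin 3) →L[ℝ] F),
      HasWeakFDerivOn Ω volume W GW → (∀ x ∈ (Ω : Set (EuclideanSpace ℝ (Fin 3))), ‖W x‖ = 1) →
      IntegrableOn (fun x => ∑ i : Fin 3, ‖GW x (EuclideanSpace.single i (1:ℝ))‖ ^ 2) (Ω : Set _) volume →
      (∃ ρ'' : ℝ, ρ'' < ρ ∧ ∀ x, x ∉ ball y ρ'' → W x = U x) →
      ∫ x in ball y ρ, ∑ i : Fin 3, ‖G x (EuclideanSpace.single i (1:ℝ))‖ ^ 2 ≤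
        ∫ x in ball y ρ, ∑ i : Fin 3, ‖GW x (EuclideanSpace.single i (1:ℝ))‖ ^ 2) :
    ∀ κ τ : ℝ, 0 < κ → κ < 1 → 0 < τ → τ < ρ →
      ∫ x in ball y ρ, (Real.smoothTransition ((1 - ‖x - y‖ ^ 2 / τ ^ 2) / κ) +
          2 * (‖x - y‖ ^ 2 / τ ^ 2) * deriv (fun s : ℝ => Real.smoothTransition ((1 - s) / κ)) (‖x - y‖ ^ 2 / τ ^ 2)) *
        ∑ i : Fin 3, ‖G x (EuclideanSpace.single i (1:ℝ))‖ ^ 2 ≤ 0 := by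
  intro κ τ hκ _hκ1 hτ hτρ
  exact radial_inequality hU hU1 hGi hB hmin (g := fun s : ℝ => Real.smoothTransition ((1 - s) / κ))
    (cutoff_contDiff κ) (fun s hs => cutoff_eq_zero hκ hs) (cutoff_deriv_nonpos hκ) hτ hτρ

end Summit.QuantumFields.YangMills.Theorems.PoincareLipschitzRadialVariation

end
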